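import Literature.AlgebraicGeometry.AbelianSchemes.AbelianSchemeOverZariskiGluingDatum
import HarnessLib

/-!
# Zariski descent of abelian-scheme structures: the glued abelian scheme and its charts

Sequel of `AbelianSchemeOverZariskiGluingDatum` (cell hodgecm-mathlib, F-DAG second hand (h7) «Zariski gluing of
`S`-objects from a cocycle», FILE 3b; consumer F-8 (8c)/(8e)).  For a `ZariskiGluingDatum S` `𝔇` — an `S`-scheme `Z`
covered by open immersions `χᵢ : Aᵢ → Z` from abelian schemes `Aᵢ → Uᵢ` over an open cover `(Uᵢ)` of `S`, with the
group laws agreeing on the double overlaps through abelian schemes `Aᵢⱼ → Uᵢ ×_S Uⱼ` — FILE 3a built functorial group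
structures on the points `Hom_S(T, Z)`.  Here:

* §1 `𝔇.grpObj : GrpObj 𝔇.Z` — the `S`-group-scheme structure on `Z` whose unit, law and inverse are the glued
  operations on the universal points `𝟙_ → Z`, `fst, snd : Z ×_S Z → Z`, `𝟙 Z` ([GortzWedhorn2020] Section (4.15): the
  three descriptions (i)–(iii) of a group scheme; the monoidal axioms are the group axioms on points plus their
  naturality); `hom_of_isZariskiLocalAtTarget` — a property local on the target passes from the charts `Aᵢ → Uᵢ` to
  `Z → S`; **`𝔇.abelianScheme : AbelianSchemeOver S`** — `Z → S` is proper, smooth and has geometrically connected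
  fibres because these are Zariski-local on the target ([GortzWedhorn2020] Def. 4.29; Mathlib
  `IsZariskiLocalAtTarget`), so [MumfordFogartyKirwan1994, Def. 6.1] holds for `Z → S`; `abelianScheme_X : _.X = 𝔇.Z`
  is `rfl`;
* §2 **`isBaseChangeVia_abelianScheme i : (𝔇.A i).IsBaseChangeVia 𝔇.abelianScheme (𝔇.𝒰.f i) (𝔇.χ i)`** — every chart
  IS the base change of the glued abelian scheme as a GROUP scheme ([MumfordFogartyKirwan1994, Def. 7.2]'s pull-back
  relation): the unit and the law of `Z` restrict to those of `Aᵢ` (`one_left_chart`, `mul_left_chart`).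

So an abelian-scheme structure is a ZARISKI-LOCAL datum on the base: this is the descent of OBJECTS road R1′ of the
F-DAG needs (slices `V_R` glued by ★ `Morphisms/GlueDataOverBase` — take `S := D.glued`, `Uᵢ := D.U i`, `Z :=` the
glued family; no Noetherian/affineness hypothesis on the `Uᵢ`).  No named fact, no `sorry`, no instance.  HC_CM is
proved only modulo the printed citations until rung 0 closes; this file discharges none of them.

## References
* [GortzWedhorn2020] U. Görtz, T. Wedhorn, *Algebraic Geometry I*, 2nd ed. (2020), Section (3.3) Prop. 3.5,
  Section (4.9) Def. 4.29 (local on the target), Section (4.15) (p. 116) / Def. 4.42 (p. 116) (group schemes, homomorphisms).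
* [MumfordFogartyKirwan1994] D. Mumford, J. Fogarty, F. Kirwan, *Geometric Invariant Theory*, 3rd ed. (1994), Ch. 6
  §1 Def. 6.1 (p. 115), Ch. 7 §2 Def. 7.2 (p. 129).
-/

noncomputable section

universe u

open CategoryTheory CategoryTheory.Limits AlgebraicGeometry MonoidalCategory CartesianMonoidalCategory
open scoped MonObj

namespace Literature.AlgebraicGeometry.AbelianSchemes

namespace AbelianSchemeOver

namespace ZariskiGluingDatum

variable {S : Scheme.{u}} (𝔇 : ZariskiGluingDatum S)

/-! ### §1 The glued group law and the glued abelian scheme -/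

/-- **The `S`-group-scheme structure on `Z` glued from the charts**: unit, law and inverse are the glued operations on
the universal points; the axioms follow from the group axioms on points (FILE 3a §3) and their naturality in `T`
([GortzWedhorn2020] Section (4.15) (ii) ⇒ (iii)). [cite: GortzWedhorn2020, Section (4.15) (p. 116)] -/
@[reducible]
def grpObj : GrpObj 𝔇.Z where
  one := 𝔇.one (𝟙_ (Over S))
  mul := 𝔇.mul (fst 𝔇.Z 𝔇.Z) (snd 𝔇.Z 𝔇.Z)
  one_mul := by
    rw [comp_mul', whiskerRight_fst, whiskerRight_snd, comp_one', one_mul', leftUnitor_hom]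
  mul_one := by
    rw [comp_mul', whiskerLeft_fst, whiskerLeft_snd, comp_one', mul_one', rightUnitor_hom]
  mul_assoc := by
    simp only [comp_mul', whiskerRight_fst, whiskerRight_snd, whiskerLeft_fst, whiskerLeft_snd,
      associator_hom_fst, associator_hom_snd_fst, associator_hom_snd_snd]
    exact 𝔇.mul_assoc' _ _ _
  inv := 𝔇.inv (𝟙 𝔇.Z)
  left_inv := by rw [comp_mul', lift_fst, lift_snd, comp_one', inv_mul']
  right_inv := by rw [comp_mul', lift_fst, lift_snd, comp_one', mul_inv']

/-- A property of morphisms which is ZARISKI-LOCAL AT THE TARGET passes from the charts `Aᵢ → Uᵢ` (the base changes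
of `Z → S` to the members of the cover, up to the isomorphisms `Aᵢ ≅ Z ×_S Uᵢ`) to `Z → S` (Mathlib
`IsZariskiLocalAtTarget.of_openCover`). [cite: GortzWedhorn2020, Section (4.9) Definition 4.29] -/
theorem hom_of_isZariskiLocalAtTarget (P : MorphismProperty Scheme.{u}) [IsZariskiLocalAtTarget P]
    (h : ∀ i, P (𝔇.A i).X.hom) : P 𝔇.Z.hom := by
  refine IsZariskiLocalAtTarget.of_openCover 𝔇.𝒰 fun i => ?_
  have key : P ((𝔇.hχ i).isoPullback.inv ≫ (𝔇.A i).X.hom) := (P.cancel_left_of_respectsIso _ _).mpr (h i)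
  have e : 𝔇.𝒰.pullbackHom 𝔇.Z.hom i = (𝔇.hχ i).isoPullback.inv ≫ (𝔇.A i).X.hom := by
    rw [(𝔇.hχ i).isoPullback_inv_snd]
    rfl
  rw [e]
  exact key

/-- **The glued abelian scheme `Z → S`** ([MumfordFogartyKirwan1994] Def. 6.1 over `S`): the glued group law `grpObj`,
and `Z → S` proper, smooth, with geometrically connected fibres — each of these is Zariski-local on the target and holds
for the charts `Aᵢ → Uᵢ`. [cite: MumfordFogartyKirwan1994, Ch. 6 §1 Definition 6.1 (p. 115)]
[cite: GortzWedhorn2020, Section (4.9) Definition 4.29] -/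
def abelianScheme : AbelianSchemeOver S where
  X := 𝔇.Z
  grpObj := 𝔇.grpObj
  isProper := 𝔇.hom_of_isZariskiLocalAtTarget @IsProper fun i => (𝔇.A i).isProper
  isSmooth := 𝔇.hom_of_isZariskiLocalAtTarget @Smooth fun i => (𝔇.A i).isSmooth
  geometricallyConnected := by
    haveI : IsZariskiLocalAtTarget @GeometricallyConnected := by
      rw [GeometricallyConnected.eq_geometrically]; infer_instance
    exact 𝔇.hom_of_isZariskiLocalAtTarget @GeometricallyConnected fun i => (𝔇.A i).geometricallyConnected

/-- The underlying `S`-scheme of the glued abelian scheme is `Z`, by construction.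
[cite: MumfordFogartyKirwan1994, Ch. 6 §1 Definition 6.1 (p. 115)] -/
@[simp]
theorem abelianScheme_X : 𝔇.abelianScheme.X = 𝔇.Z := rfl

/-- The unit of the glued abelian scheme is the glued unit point of `Z` over `𝟙_ = S`.
[cite: GortzWedhorn2020, Section (4.15) (p. 116)] -/
theorem one_eq : η[𝔇.abelianScheme.X] = 𝔇.one (𝟙_ (Over S)) := rfl

/-- The law of the glued abelian scheme is the glued product of the two projections `Z ×_S Z → Z`.
[cite: GortzWedhorn2020, Section (4.15) (p. 116)] -/
theorem mul_eq : μ[𝔇.abelianScheme.X] = 𝔇.mul (fst 𝔇.Z 𝔇.Z) (snd 𝔇.Z 𝔇.Z) := rfl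

/-! ### §2 The charts are base changes of the glued abelian scheme -/

/-- A section `x` of a chart `Aᵢ → Uᵢ` which is the restriction of a section `f` of `Z → S` maps under `χᵢ` to
`(Uᵢ → S) ≫ f`: the section clause of [MumfordFogartyKirwan1994] Def. 7.2's pull-back relation, read on the chart
`S ×_S Uᵢ ≅ Uᵢ`. [cite: MumfordFogartyKirwan1994, Ch. 7 §2 Definition 7.2 (p. 129)] -/
theorem left_comp_χ_of_res_eq (f : 𝟙_ (Over S) ⟶ 𝔇.Z) (i : 𝔇.𝒰.I₀) (x : 𝟙_ (Over (𝔇.𝒰.X i)) ⟶ (𝔇.A i).X)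
    (h : 𝔇.res f i = toUnit _ ≫ x) : x.left ≫ 𝔇.χ i = 𝔇.𝒰.f i ≫ f.left := by
  let s : 𝔇.𝒰.X i ⟶ pullback (𝟙_ (Over S)).hom (𝔇.𝒰.f i) := pullback.lift (𝔇.𝒰.f i) (𝟙 _) (by simp)
  have hs₁ : s ≫ pullback.fst _ _ = 𝔇.𝒰.f i := pullback.lift_fst _ _ _
  have hs₂ : s ≫ pullback.snd _ _ = 𝟙 _ := pullback.lift_snd _ _ _
  have key := 𝔇.res_left_comp_χ f i
  rw [h, Over.comp_left, Over.toUnit_left] at key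
  erw [Category.assoc] at key
  refine (?_ : x.left ≫ 𝔇.χ i = (s ≫ pullback.snd _ _) ≫ x.left ≫ 𝔇.χ i).trans ?_
  · rw [hs₂]; exact (Category.id_comp _).symm
  refine (Category.assoc _ _ _).trans ?_
  refine (congrArg (s ≫ ·) key).trans ?_
  refine (Category.assoc _ _ _).symm.trans ?_
  exact congrArg (· ≫ f.left) hs₁

/-- The unit section of the glued abelian scheme restricts to the unit section of each chart:
`ηᵢ ≫ χᵢ = (Uᵢ → S) ≫ η`. [cite: MumfordFogartyKirwan1994, Ch. 7 §2 Definition 7.2 (p. 129)]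
[cite: GortzWedhorn2020, Section (4.15) (p. 116)] -/
theorem one_left_chart (i : 𝔇.𝒰.I₀) : η[(𝔇.A i).X].left ≫ 𝔇.χ i = 𝔇.𝒰.f i ≫ η[𝔇.abelianScheme.X].left :=
  𝔇.left_comp_χ_of_res_eq (𝔇.one (𝟙_ (Over S))) i η[(𝔇.A i).X] (by rw [res_one, Hom.one_def])

/-- The law of the glued abelian scheme restricts to the law of each chart: `μᵢ ≫ χᵢ = (χᵢ × χᵢ) ≫ μ`.
[cite: MumfordFogartyKirwan1994, Ch. 7 §2 Definition 7.2 (p. 129)] [cite: GortzWedhorn2020, Section (4.15) Definition 4.42 (p. 116)] -/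
theorem mul_left_chart (i : 𝔇.𝒰.I₀) :
    μ[(𝔇.A i).X].left ≫ 𝔇.χ i =
      pullback.map (𝔇.A i).X.hom (𝔇.A i).X.hom 𝔇.Z.hom 𝔇.Z.hom (𝔇.χ i) (𝔇.χ i) (𝔇.𝒰.f i)
        (𝔇.hχ i).w.symm (𝔇.hχ i).w.symm ≫ μ[𝔇.abelianScheme.X].left := by
  set m := pullback.map (𝔇.A i).X.hom (𝔇.A i).X.hom 𝔇.Z.hom 𝔇.Z.hom (𝔇.χ i) (𝔇.χ i) (𝔇.𝒰.f i)
    (𝔇.hχ i).w.symm (𝔇.hχ i).w.symm with hm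
  have hm₁ : m ≫ pullback.fst _ _ = pullback.fst _ _ ≫ 𝔇.χ i := pullback.lift_fst _ _ _
  have hm₂ : m ≫ pullback.snd _ _ = pullback.snd _ _ ≫ 𝔇.χ i := pullback.lift_snd _ _ _
  -- the chart of `Z ×_S Z` over `Uᵢ` receives `Aᵢ ×_{Uᵢ} Aᵢ`
  let s : ((𝔇.A i).X ⊗ (𝔇.A i).X).left ⟶ pullback (𝔇.Z ⊗ 𝔇.Z).hom (𝔇.𝒰.f i) :=
    pullback.lift m ((𝔇.A i).X ⊗ (𝔇.A i).X).hom (by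
      show m ≫ pullback.fst _ _ ≫ 𝔇.Z.hom = (pullback.fst _ _ ≫ (𝔇.A i).X.hom) ≫ 𝔇.𝒰.f i
      rw [reassoc_of% hm₁, (𝔇.hχ i).w, Category.assoc])
  have hs₁ : s ≫ pullback.fst _ _ = m := pullback.lift_fst _ _ _
  let s' : (𝔇.A i).X ⊗ (𝔇.A i).X ⟶ 𝔇.chart (𝔇.Z ⊗ 𝔇.Z) i := Over.homMk s (pullback.lift_snd _ _ _)
  have h₁ : s' ≫ 𝔇.res (fst 𝔇.Z 𝔇.Z) i = fst _ _ := by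
    refine 𝔇.hom_ext_χ _ _ ?_
    show (s ≫ (𝔇.res (fst 𝔇.Z 𝔇.Z) i).left) ≫ 𝔇.χ i = pullback.fst _ _ ≫ 𝔇.χ i
    erw [Category.assoc, 𝔇.res_left_comp_χ, reassoc_of% hs₁, Over.fst_left, hm₁]
  have h₂ : s' ≫ 𝔇.res (snd 𝔇.Z 𝔇.Z) i = snd _ _ := by
    refine 𝔇.hom_ext_χ _ _ ?_
    show (s ≫ (𝔇.res (snd 𝔇.Z 𝔇.Z) i).left) ≫ 𝔇.χ i = pullback.snd _ _ ≫ 𝔇.χ i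
    erw [Category.assoc, 𝔇.res_left_comp_χ, reassoc_of% hs₁, Over.snd_left, hm₂]
  have key := 𝔇.res_left_comp_χ (𝔇.mul (fst 𝔇.Z 𝔇.Z) (snd 𝔇.Z 𝔇.Z)) i
  rw [res_mul] at key
  -- key : (res fst * res snd).left ≫ χ i = pullback.fst _ _ ≫ (mul fst snd).left
  have e : s ≫ (𝔇.res (fst 𝔇.Z 𝔇.Z) i * 𝔇.res (snd 𝔇.Z 𝔇.Z) i).left = μ[(𝔇.A i).X].left := by
    have := congrArg Over.Hom.left (MonObj.comp_mul s' (𝔇.res (fst 𝔇.Z 𝔇.Z) i) (𝔇.res (snd 𝔇.Z 𝔇.Z) i))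
    rw [h₁, h₂, ← MonObj.mul_eq_mul, Over.comp_left] at this
    exact this
  symm
  refine (?_ : m ≫ μ[𝔇.abelianScheme.X].left =
    (s ≫ pullback.fst _ _) ≫ (𝔇.mul (fst 𝔇.Z 𝔇.Z) (snd 𝔇.Z 𝔇.Z)).left).trans ?_
  · exact congrArg (· ≫ (𝔇.mul (fst 𝔇.Z 𝔇.Z) (snd 𝔇.Z 𝔇.Z)).left) hs₁.symm
  refine (Category.assoc _ _ _).trans ?_
  refine (congrArg (s ≫ ·) key.symm).trans ?_
  refine (Category.assoc _ _ _).symm.trans ?_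
  exact congrArg (· ≫ 𝔇.χ i) e

/-- **Each chart `Aᵢ → Uᵢ` is the base change of the glued abelian scheme along `Uᵢ → S`, via `χᵢ`, AS A GROUP SCHEME**
(the tree's `IsBaseChangeVia`: cartesian square + unit + law). [cite: MumfordFogartyKirwan1994, Ch. 7 §2 Definition 7.2 (p. 129)]
[cite: GortzWedhorn2020, Section (4.15) (p. 116)] -/
theorem isBaseChangeVia_abelianScheme (i : 𝔇.𝒰.I₀) :
    (𝔇.A i).IsBaseChangeVia 𝔇.abelianScheme (𝔇.𝒰.f i) (𝔇.χ i) :=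
  ⟨(𝔇.hχ i).w, 𝔇.hχ i, 𝔇.one_left_chart i, 𝔇.mul_left_chart i⟩

/-- Relative dimension of the glued abelian scheme: if every chart is of relative dimension `g`, so is `Z → S`
(`SmoothOfRelativeDimension` is Zariski-local on the target). [cite: GortzWedhorn2020, Section (4.9) Definition 4.29] -/
theorem isOfRelDim_abelianScheme {g : ℕ} (h : ∀ i, (𝔇.A i).IsOfRelDim g) : 𝔇.abelianScheme.IsOfRelDim g :=
  𝔇.hom_of_isZariskiLocalAtTarget (@SmoothOfRelativeDimension g) h

end ZariskiGluingDatum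

end AbelianSchemeOver

end Literature.AlgebraicGeometry.AbelianSchemes

end
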